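import Summits.HubbardSuperconductivity.HubbardSuperconductivity.Theorems.NodalDiracTwistBridgeNodalToDWaveDiagonalParityFlip
import Summits.HubbardSuperconductivity.HubbardSuperconductivity.Theorems.NodalDiracTwistBridgeNodalToDWaveMomentumTube
import Summits.HubbardSuperconductivity.HubbardSuperconductivity.Theorems.NodalDiracTwistNodalDiracWeakCouplingAnnulusCore

/-!
# The swap parity along the diagonal of twist space (crux `BridgeNodalToDWave`, line `birth`)

Route `HubbardSuperconductivity/NodalDiracTwist`, crux stmt-HubbardSuperconductivity-10395
(`BridgeNodalToDWave`), skeleton `Cruxes/BridgeNodalToDWave/Lines/birth.lean`, structural input to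
stub C (`stub_classificationCore`), lead c12.  Companion of
`NodalDiracTwistBridgeNodalToDWaveDiagonalParityFlip.lean` (the parity flip ACROSS a diagonal
Dirac point).  Here: the parity is CONSTANT along diagonal segments of uniqueness, and the global
consequence for the nodal-Dirac package.

On the diagonal `φ = (t, t)` the swap `(x₀, x₁) ↦ (x₁, x₀)` (`U_{sr 3} = fockD4 (sr 3)`) is a
symmetry of the spin-twisted torus `H_L(U, φ)`, so a unique `(N, S^z = 0)` sector ground state
there is a `±1` eigenvector of it (`swap_mulVec_eq_self_or_eq_neg_of_diagonal`).

* `swapSign_eq_of_near_diagonal`, `swapSign_const_on_diagonal_segment` — if the sector ground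
  state is unique at every diagonal twist `(t, t)`, `t ∈ [a, b]`, its swap sign is the same at all
  of them (uniform overlap on the compact segment, `uniform_overlap_of_isCompact`; neighbouring
  ground states have non-zero overlap, and `⟨χ, χ'⟩ = conj(s) s' ⟨χ, χ'⟩` by unitarity).
* `swapSign_pi_opposite_swapSign_zero` — **global form for the package**: if clause (I) of the
  nodal-Dirac package holds on the cell with `0 < c < π` (the sector ground state is degenerate
  exactly at `(±c, ±c)`) and the holonomy clause (II) holds at `(c, c)` for one radius
  `0 < r < min(c, π - c)`, then the `x ↔ y` parity of the (unique) UNTWISTED sector ground state of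
  `hubbardTorus 2 L 1 U` and that of the (unique) sector ground state at the twist `(π, π)` are
  OPPOSITE (`L ≥ 3`): constancy on `[0, c - r/√2]` and on `[c + r/√2, π]`, and the flip across
  `(c, c)` (`swapSign_opposite_of_holonomy_neg`).  Registered sub-goal `stub_swapParityZeroVsPi`.

A kernel-checked, exact-diagonalisation-testable necessary condition on any state realising the
package (binding on cruxes stmt-10370 / stmt-1622 too): for a `d_{x²-y²}` paired state the swap
parity of `N/2` pairs is `(-1)^{N/2}` at zero twist, and the package predicts the opposite parity
after the opposite spin boosts `(π, π)`.

## References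

Y. Hatsugai, J. Phys. Soc. Jpn. 75 (2006) 123601; T. Kato, *Perturbation Theory for Linear
Operators* (1966), II §5.1 (continuity of an isolated eigenvector); D. J. Scalapino, Phys. Rep.
250 (1995) 329, §2. No new definitions, no named facts.
-/

-- the mandated namespace repeats `HubbardSuperconductivity` (single-problem summit, D-0017)
set_option linter.dupNamespace false

noncomputable section

namespace Summit.HubbardSuperconductivity.HubbardSuperconductivity.Theorems.NodalDiracTwist.BridgeNodalToDWave

open Matrix Literature.MathematicalPhysics.QuantumLattice Literature.Probability.LatticeModels
open Summit.HubbardSuperconductivity.HubbardSuperconductivity.Theorems.NodalDiracTwist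

section Segment

variable (L : ℕ) [NeZero L]

/-- **A unique sector ground state at a diagonal twist is a `±1` eigenvector of the swap.**
(`relabel_swap_of_diagonal` + `fockRelabel_mapEquiv_mulVec_eq_self_or_eq_neg`.) Hatsugai (2006).
[folklore] -/
theorem swap_mulVec_eq_self_or_eq_neg_of_diagonal {U : ℝ} {N : ℕ} {t : ℝ}
    {χ : Fock (Orb (FermionTorus 2 L))}
    (hχ : IsGroundStateInSector (spinTwistedHubbardTorus L U (fun _ : Fin 2 => t)) N 0 χ)
    (huniq : ∀ χ', IsGroundStateInSector (spinTwistedHubbardTorus L U (fun _ : Fin 2 => t)) N 0 χ' →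
      ∃ z : ℂ, χ' = z • χ) :
    (fockD4 (L := L) (DihedralGroup.sr 3)).val *ᵥ χ = χ ∨
      (fockD4 (L := L) (DihedralGroup.sr 3)).val *ᵥ χ = -χ := by
  have h := fockRelabel_mapEquiv_mulVec_eq_self_or_eq_neg L _
    (relabel_swap_of_diagonal L U (φ := fun _ : Fin 2 => t) rfl) hχ huniq
  rwa [← Orb.d4Perm_eq_mapEquiv] at h

/-- A sector ground state at a diagonal twist of uniqueness is a swap eigenvector. [folklore] -/
theorem exists_swap_mulVec_eq_smul_of_diagonal {U : ℝ} {N : ℕ} {t : ℝ}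
    {χ : Fock (Orb (FermionTorus 2 L))}
    (hχ : IsGroundStateInSector (spinTwistedHubbardTorus L U (fun _ : Fin 2 => t)) N 0 χ)
    (huniq : ∀ χ', IsGroundStateInSector (spinTwistedHubbardTorus L U (fun _ : Fin 2 => t)) N 0 χ' →
      ∃ z : ℂ, χ' = z • χ) :
    ∃ s : ℂ, (fockD4 (L := L) (DihedralGroup.sr 3)).val *ᵥ χ = s • χ := by
  rcases swap_mulVec_eq_self_or_eq_neg_of_diagonal L hχ huniq with h | h
  · exact ⟨1, by rw [h, one_smul]⟩
  · exact ⟨-1, by rw [h, neg_one_smul]⟩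

/-- **Nearby diagonal twists of uniqueness carry the same swap sign.**  If the `(N, S^z = 0)`
sector ground state of `H_L(U, (t,t))` is unique up to scalars for every `t ∈ [a, b]`, there is
`δ > 0` such that for `t, t' ∈ [a, b]` with `|t - t'| < δ`, sector ground states `χ` at `(t,t)` and
`χ'` at `(t',t')` with `U_{sr 3} χ = s χ`, `U_{sr 3} χ' = s' χ'` have `s = s'`.
(`uniform_overlap_of_isCompact` on the compact diagonal segment with `ε = 1` gives a non-zero
overlap of the unit multiples; unitarity gives `⟨χ, χ'⟩ = conj(s) s' ⟨χ, χ'⟩`; `s = ±1`.)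
Kato (1966) II §5.1; Hatsugai (2006). [folklore] -/
theorem swapSign_eq_of_near_diagonal (U : ℝ) (N : ℕ) (a b : ℝ)
    (huniq : ∀ t ∈ Set.Icc a b, ∀ χ₁ χ₂ : Fock (Orb (FermionTorus 2 L)),
      IsGroundStateInSector (spinTwistedHubbardTorus L U (fun _ : Fin 2 => t)) N 0 χ₁ →
      IsGroundStateInSector (spinTwistedHubbardTorus L U (fun _ : Fin 2 => t)) N 0 χ₂ →
      ∃ z : ℂ, χ₂ = z • χ₁) :
    ∃ δ : ℝ, 0 < δ ∧ ∀ t ∈ Set.Icc a b, ∀ t' ∈ Set.Icc a b, |t - t'| < δ →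
      ∀ (χ χ' : Fock (Orb (FermionTorus 2 L))) (s s' : ℂ),
      IsGroundStateInSector (spinTwistedHubbardTorus L U (fun _ : Fin 2 => t)) N 0 χ →
      IsGroundStateInSector (spinTwistedHubbardTorus L U (fun _ : Fin 2 => t')) N 0 χ' →
      (fockD4 (L := L) (DihedralGroup.sr 3)).val *ᵥ χ = s • χ →
      (fockD4 (L := L) (DihedralGroup.sr 3)).val *ᵥ χ' = s' • χ' → s = s' := by
  classical
  -- the compact diagonal segment as a base set
  set D : Set (Fin 2 → ℝ) := (fun t : ℝ => fun _ : Fin 2 => t) '' Set.Icc a b with hD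
  have hDc : IsCompact D := isCompact_Icc.image (continuous_pi fun _ => continuous_id)
  have hlb : ∀ φ : Fin 2 → ℝ, ∀ v ∈ (szSector N 0 : Submodule ℂ (Fock (Orb (FermionTorus 2 L)))),
      star v ⬝ᵥ v = 1 →
      (spinTwistedHubbardTorus L U φ).minEnergyOn (szSector N 0) ≤
        (star v ⬝ᵥ spinTwistedHubbardTorus L U φ *ᵥ v).re :=
    fun φ v hv h1 => minEnergyOn_le_rayleigh_of_mem (spinTwistedHubbardTorus_isHermitian L U φ) _ hv h1
  have huniqD : ∀ φ ∈ D, ∀ χ₁ χ₂ : Fock (Orb (FermionTorus 2 L)),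
      (χ₁ ∈ (szSector N 0 : Submodule ℂ (Fock (Orb (FermionTorus 2 L)))) ∧ χ₁ ≠ 0 ∧
        spinTwistedHubbardTorus L U φ *ᵥ χ₁ =
          (((spinTwistedHubbardTorus L U φ).minEnergyOn (szSector N 0) : ℝ) : ℂ) • χ₁) →
      (χ₂ ∈ (szSector N 0 : Submodule ℂ (Fock (Orb (FermionTorus 2 L)))) ∧ χ₂ ≠ 0 ∧
        spinTwistedHubbardTorus L U φ *ᵥ χ₂ =
          (((spinTwistedHubbardTorus L U φ).minEnergyOn (szSector N 0) : ℝ) : ℂ) • χ₂) →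
      ∃ z : ℂ, χ₂ = z • χ₁ := by
    rintro φ ⟨t, ht, rfl⟩ χ₁ χ₂ h₁ h₂
    exact huniq t ht χ₁ χ₂ h₁ h₂
  obtain ⟨δ, hδ, hov⟩ := uniform_overlap_of_isCompact (szSector N 0) (spinTwistedHubbardTorus L U)
    (continuous_spinTwistedHubbardTorus L U) hDc hlb huniqD one_pos
  refine ⟨δ, hδ, fun t ht t' ht' hd χ χ' s s' hχ hχ' hs hs' => ?_⟩
  -- `s = ±1`
  have hs1 : s = 1 ∨ s = -1 := by
    rcases swap_mulVec_eq_self_or_eq_neg_of_diagonal L hχ (fun χ'' h => huniq t ht χ χ'' hχ h) with h | h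
    · left
      have h2 : (s - 1) • χ = 0 := by rw [sub_smul, one_smul, ← hs, h, sub_self]
      exact sub_eq_zero.1 ((smul_eq_zero.1 h2).resolve_right hχ.2.1)
    · right
      have h2 : (s - (-1)) • χ = 0 := by rw [sub_smul, neg_one_smul, ← hs, h, sub_self]
      exact sub_eq_zero.1 ((smul_eq_zero.1 h2).resolve_right hχ.2.1)
  -- unit multiples and their non-vanishing overlap
  obtain ⟨c, hc, hcu⟩ := exists_smul_unit hχ.2.1
  obtain ⟨c', hc', hcu'⟩ := exists_smul_unit hχ'.2.1
  have hdist : dist (fun _ : Fin 2 => t) (fun _ : Fin 2 => t') < δ := by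
    rw [dist_pi_const, Real.dist_eq]
    exact hd
  have hov1 := hov _ ⟨t, ht, rfl⟩ _ ⟨t', ht', rfl⟩ hdist (c • χ) (c' • χ')
    (isGroundStateInSector_smul hχ hc) hcu (isGroundStateInSector_smul hχ' hc') hcu'
  have hne : star χ ⬝ᵥ χ' ≠ 0 := by
    intro h0
    have : star (c • χ) ⬝ᵥ (c' • χ') = 0 := by
      rw [star_smul, smul_dotProduct, dotProduct_smul, h0, smul_zero, smul_zero]
    rw [this, norm_zero] at hov1
    norm_num at hov1
  -- unitarity of the swap
  have hU := star_fockRelabel_mulVec_dotProduct_fockRelabel_mulVec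
    (Orb.d4Perm (L := L) (DihedralGroup.sr 3)) χ χ'
  rw [show (fockRelabel (Orb.d4Perm (L := L) (DihedralGroup.sr 3))).val *ᵥ χ = s • χ from hs,
    show (fockRelabel (Orb.d4Perm (L := L) (DihedralGroup.sr 3))).val *ᵥ χ' = s' • χ' from hs',
    star_smul, smul_dotProduct, dotProduct_smul, smul_smul, smul_eq_mul] at hU
  have hss : star s * s' = 1 := mul_right_cancel₀ hne (hU.trans (one_mul _).symm)
  rcases hs1 with rfl | rfl
  · rw [star_one, one_mul] at hss
    exact hss.symm
  · rw [star_neg, star_one, neg_one_mul, neg_eq_iff_eq_neg] at hss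
    exact hss.symm

/-- **The swap sign is constant along a diagonal segment of uniqueness.**  If the `(N, S^z = 0)`
sector ground state of `H_L(U, (t,t))` is unique up to scalars for every `t ∈ [a, b]`, there is ONE
scalar `s` (necessarily `±1` when ground states exist) with `U_{sr 3} χ = s χ` for every sector
ground state `χ` at every `(t,t)`, `t ∈ [a, b]` (chain the segment in steps shorter than the `δ`
of `swapSign_eq_of_near_diagonal`). Kato (1966) II §5.1; Hatsugai (2006). [folklore] -/
theorem swapSign_const_on_diagonal_segment (U : ℝ) (N : ℕ) (a b : ℝ)
    (huniq : ∀ t ∈ Set.Icc a b, ∀ χ₁ χ₂ : Fock (Orb (FermionTorus 2 L)),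
      IsGroundStateInSector (spinTwistedHubbardTorus L U (fun _ : Fin 2 => t)) N 0 χ₁ →
      IsGroundStateInSector (spinTwistedHubbardTorus L U (fun _ : Fin 2 => t)) N 0 χ₂ →
      ∃ z : ℂ, χ₂ = z • χ₁) :
    ∃ s : ℂ, ∀ t ∈ Set.Icc a b, ∀ χ : Fock (Orb (FermionTorus 2 L)),
      IsGroundStateInSector (spinTwistedHubbardTorus L U (fun _ : Fin 2 => t)) N 0 χ →
      (fockD4 (L := L) (DihedralGroup.sr 3)).val *ᵥ χ = s • χ := by
  classical
  obtain ⟨δ, hδ, hnear⟩ := swapSign_eq_of_near_diagonal L U N a b huniq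
  have heig : ∀ t ∈ Set.Icc a b, ∀ χ,
      IsGroundStateInSector (spinTwistedHubbardTorus L U (fun _ : Fin 2 => t)) N 0 χ →
      ∃ s : ℂ, (fockD4 (L := L) (DihedralGroup.sr 3)).val *ᵥ χ = s • χ := fun t ht χ hχ =>
    exists_swap_mulVec_eq_smul_of_diagonal L hχ (fun χ'' h => huniq t ht χ χ'' hχ h)
  by_cases hex : ∃ t₀ ∈ Set.Icc a b, ∃ χ₀,
      IsGroundStateInSector (spinTwistedHubbardTorus L U (fun _ : Fin 2 => t₀)) N 0 χ₀
  · obtain ⟨t₀, ht₀, χ₀, hχ₀⟩ := hex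
    obtain ⟨s₀, hs₀⟩ := heig t₀ ht₀ χ₀ hχ₀
    refine ⟨s₀, fun t ht χ hχ => ?_⟩
    -- the sector is non-trivial, so every twist carries a sector ground state
    have hK : (szSector N 0 : Submodule ℂ (Fock (Orb (FermionTorus 2 L)))) ≠ ⊥ :=
      (Submodule.ne_bot_iff _).2 ⟨χ₀, hχ₀.1, hχ₀.2.1⟩
    have hexist : ∀ τ : ℝ, ∃ ξ,
        IsGroundStateInSector (spinTwistedHubbardTorus L U (fun _ : Fin 2 => τ)) N 0 ξ := fun τ => by
      obtain ⟨v, hv, h1, he⟩ := exists_unit_eigen_minEnergyOn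
        (spinTwistedHubbardTorus_isHermitian L U (fun _ : Fin 2 => τ)) (szSector N 0)
        (fun v hv => spinTwistedHubbardTorus_mulVec_mem_szSector L U _ hv) hK
      exact ⟨v, hv, ne_zero_of_unit h1, he⟩
    -- the chain from `t₀` to `t`
    obtain ⟨m, hm⟩ : ∃ m : ℕ, |t - t₀| / δ < m := exists_nat_gt _
    have hm0 : 0 < (m : ℝ) := lt_of_le_of_lt (div_nonneg (abs_nonneg _) hδ.le) hm
    have hstep : |t - t₀| / m < δ := by
      rw [div_lt_iff₀ hm0]
      calc |t - t₀| = |t - t₀| / δ * δ := by field_simp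
        _ < m * δ := mul_lt_mul_of_pos_right hm hδ
        _ = δ * m := mul_comm _ _
    set τ : ℕ → ℝ := fun j => t₀ + ((j : ℝ) / m) * (t - t₀) with hτ
    have hτmem : ∀ j : ℕ, j ≤ m → τ j ∈ Set.Icc a b := by
      intro j hj
      have hl0 : 0 ≤ (j : ℝ) / m := div_nonneg (Nat.cast_nonneg j) hm0.le
      have hl1 : (j : ℝ) / m ≤ 1 := (div_le_one hm0).2 (by exact_mod_cast hj)
      simp only [hτ, Set.mem_Icc]
      constructor
      · nlinarith [ht₀.1, ht.1, mul_nonneg hl0 (sub_nonneg.2 ht.1),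
          mul_nonneg (sub_nonneg.2 hl1) (sub_nonneg.2 ht₀.1)]
      · nlinarith [ht₀.2, ht.2, mul_nonneg hl0 (sub_nonneg.2 ht.2),
          mul_nonneg (sub_nonneg.2 hl1) (sub_nonneg.2 ht₀.2)]
    have hτdist : ∀ j : ℕ, |τ j - τ (j + 1)| < δ := fun j => by
      have h : τ j - τ (j + 1) = -((1 / m) * (t - t₀)) := by
        simp only [hτ]
        push_cast
        ring
      rw [h, abs_neg, abs_mul, abs_of_pos (by positivity : (0 : ℝ) < 1 / m), one_div_mul_eq_div]
      exact hstep
    -- induction along the chain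
    have hchain : ∀ j : ℕ, j ≤ m → ∀ ξ s,
        IsGroundStateInSector (spinTwistedHubbardTorus L U (fun _ : Fin 2 => τ j)) N 0 ξ →
        (fockD4 (L := L) (DihedralGroup.sr 3)).val *ᵥ ξ = s • ξ → s = s₀ := by
      intro j
      induction j with
      | zero =>
        intro _ ξ s hξ hs
        have hτ0 : τ 0 = t₀ := by simp [hτ]
        rw [hτ0] at hξ
        exact (hnear t₀ ht₀ t₀ ht₀ (by rw [sub_self, abs_zero]; exact hδ) χ₀ ξ s₀ s hχ₀ hξ hs₀ hs).symm
      | succ j ih =>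
        intro hj ξ s hξ hs
        obtain ⟨ξ', hξ'⟩ := hexist (τ j)
        obtain ⟨s', hs'⟩ := heig (τ j) (hτmem j (by omega)) ξ' hξ'
        have h1 : s' = s₀ := ih (by omega) ξ' s' hξ' hs'
        have h2 : s' = s := hnear (τ j) (hτmem j (by omega)) (τ (j + 1)) (hτmem (j + 1) hj)
          (hτdist j) ξ' ξ s' s hξ' hξ hs' hs
        rw [← h2, h1]
    -- the endpoint of the chain is `t`
    have hτm : τ m = t := by
      simp only [hτ]
      rw [div_self hm0.ne', one_mul, add_sub_cancel]
    obtain ⟨s, hs⟩ := heig t ht χ hχ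
    have hξ : IsGroundStateInSector (spinTwistedHubbardTorus L U (fun _ : Fin 2 => τ m)) N 0 χ := by
      rw [hτm]; exact hχ
    rw [hs, hchain m le_rfl χ s hξ hs]
  · -- no ground state anywhere on the segment: vacuous
    push Not at hex
    exact ⟨1, fun t ht χ hχ => (hex t ht χ hχ).elim⟩

end Segment

/-! ### The global consequence for the nodal-Dirac package -/

section Global

variable (L : ℕ) [NeZero L]

/-- **Under clauses (I) and (II) of the nodal-Dirac package, the swap parities of the untwisted
sector ground state and of the sector ground state at the twist `(π, π)` are opposite.**  Let
`0 < c < π`; suppose the `(N, S^z = 0)` sector ground state of `H_L(U, φ)` is degenerate exactly at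
the twists `(±c, ±c)` of the cell `(-π, π]²` (clause (I)), and the holonomy clause (II) holds at the
diagonal Dirac point `p = (c, c)` for a radius `0 < r < min(c, π - c)` (so `0 < c < π`).  Then (for `L ≥ 3`, so that
`H_L(U, 0) = hubbardTorus 2 L 1 U`) every sector ground state `χ₀` of `hubbardTorus 2 L 1 U` and
every sector ground state `χπ` of `H_L(U, (π, π))` satisfy `U_{sr 3} χ₀ = ± χ₀`,
`U_{sr 3} χπ = ∓ χπ` with opposite signs.  (Uniqueness along the diagonal off `t = ±c` by (I) and
Gram–Schmidt; constancy of the sign on `[0, c - r/√2]` and on `[c + r/√2, π]`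
(`swapSign_const_on_diagonal_segment`); the flip across `(c, c)`
(`swapSign_opposite_of_holonomy_neg`).) Hatsugai (2006); Kato (1966) II §5.1. [folklore] -/
theorem swapSign_pi_opposite_swapSign_zero (hL : 3 ≤ L) (U : ℝ) (N : ℕ) {c : ℝ}
    (hI : ∀ φ : Fin 2 → ℝ, φ 0 ∈ Set.Ioc (-Real.pi) Real.pi → φ 1 ∈ Set.Ioc (-Real.pi) Real.pi →
      ((∃ ψ₁ ψ₂ : Fock (Orb (FermionTorus 2 L)),
        IsGroundStateInSector (spinTwistedHubbardTorus L U φ) N 0 ψ₁ ∧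
        IsGroundStateInSector (spinTwistedHubbardTorus L U φ) N 0 ψ₂ ∧ star ψ₁ ⬝ᵥ ψ₂ = 0) ↔
        (|φ 0| = c ∧ |φ 1| = c)))
    (p : Fin 2 → ℝ) (hp0 : p 0 = c) (hp1 : p 1 = c) {r : ℝ} (hr0 : 0 < r)
    (hrc : r < min c (Real.pi - c))
    (hII : ∃ n₀ : ℕ, ∀ n ≥ n₀, ∀ ψ : Fin n → Fock (Orb (FermionTorus 2 L)),
      (∀ i : Fin n, IsGroundStateInSector (spinTwistedHubbardTorus L U (fun ν : Fin 2 => p ν +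
        r * (if ν = 0 then Real.cos (2 * Real.pi * (i : ℕ) / n)
          else Real.sin (2 * Real.pi * (i : ℕ) / n)))) N 0 (ψ i) ∧ star (ψ i) ⬝ᵥ ψ i = 1) →
      (∏ i : Fin n, star (ψ i) ⬝ᵥ ψ (finRotate n i)).re < 0)
    {χ₀ χπ : Fock (Orb (FermionTorus 2 L))}
    (hχ₀ : IsGroundStateInSector (hubbardTorus 2 L 1 U) N 0 χ₀)
    (hχπ : IsGroundStateInSector (spinTwistedHubbardTorus L U (fun _ : Fin 2 => Real.pi)) N 0 χπ) :
    ((fockD4 (L := L) (DihedralGroup.sr 3)).val *ᵥ χ₀ = χ₀ ∧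
        (fockD4 (L := L) (DihedralGroup.sr 3)).val *ᵥ χπ = -χπ) ∨
      ((fockD4 (L := L) (DihedralGroup.sr 3)).val *ᵥ χ₀ = -χ₀ ∧
        (fockD4 (L := L) (DihedralGroup.sr 3)).val *ᵥ χπ = χπ) := by
  classical
  have hp : p = fun _ : Fin 2 => c := by
    funext ν; fin_cases ν <;> assumption
  subst hp
  obtain ⟨hrc', hrπ⟩ := lt_min_iff.1 hrc
  -- uniqueness at diagonal twists of the cell off `t = ± c` (clause (I) + Gram–Schmidt)
  have huniq_diag : ∀ t : ℝ, -Real.pi < t → t ≤ Real.pi → |t| ≠ c →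
      ∀ χ₁ χ₂ : Fock (Orb (FermionTorus 2 L)),
      IsGroundStateInSector (spinTwistedHubbardTorus L U (fun _ : Fin 2 => t)) N 0 χ₁ →
      IsGroundStateInSector (spinTwistedHubbardTorus L U (fun _ : Fin 2 => t)) N 0 χ₂ →
      ∃ z : ℂ, χ₂ = z • χ₁ := by
    intro t ht1 ht2 htc χ₁ χ₂ h₁ h₂
    refine unique_of_no_orthogonal_pair (fun h => ?_) χ₁ χ₂ h₁ h₂
    exact htc ((hI (fun _ : Fin 2 => t) ⟨ht1, ht2⟩ ⟨ht1, ht2⟩).1 h).1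
  -- the two diagonal vertices `t± = c ± r/√2`
  set κ : ℝ := Real.sqrt 2 / 2 with hκ
  have hκ0 : 0 < κ := by positivity
  have hκ1 : κ < 1 := by
    have h2 : Real.sqrt 2 * Real.sqrt 2 = 2 := Real.mul_self_sqrt (by norm_num)
    nlinarith [Real.sqrt_nonneg 2]
  have hrκ : r * κ < r := mul_lt_of_lt_one_right hr0 hκ1
  have hrκ0 : 0 < r * κ := mul_pos hr0 hκ0
  set tp : ℝ := c + r * κ with htp
  set tm : ℝ := c - r * κ with htm
  have h5c : Real.cos (5 * Real.pi / 4) = -κ := by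
    rw [show 5 * Real.pi / 4 = Real.pi / 4 + Real.pi by ring, Real.cos_add_pi, Real.cos_pi_div_four]
  have h5s : Real.sin (5 * Real.pi / 4) = -κ := by
    rw [show 5 * Real.pi / 4 = Real.pi / 4 + Real.pi by ring, Real.sin_add_pi, Real.sin_pi_div_four]
  have hqp : (fun ν : Fin 2 => (fun _ : Fin 2 => c) ν +
      r * (if ν = 0 then Real.cos (Real.pi / 4) else Real.sin (Real.pi / 4))) = fun _ : Fin 2 => tp := by
    funext ν
    fin_cases ν <;> simp [Real.cos_pi_div_four, Real.sin_pi_div_four, htp, hκ]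
  have hqm : (fun ν : Fin 2 => (fun _ : Fin 2 => c) ν +
      r * (if ν = 0 then Real.cos (5 * Real.pi / 4) else Real.sin (5 * Real.pi / 4))) =
      fun _ : Fin 2 => tm := by
    funext ν
    fin_cases ν <;> simp [h5c, h5s, htm] <;> ring
  -- uniqueness on the two diagonal segments `[0, tm]` and `[tp, π]`
  have huniq_lo : ∀ t ∈ Set.Icc 0 tm, ∀ χ₁ χ₂ : Fock (Orb (FermionTorus 2 L)),
      IsGroundStateInSector (spinTwistedHubbardTorus L U (fun _ : Fin 2 => t)) N 0 χ₁ →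
      IsGroundStateInSector (spinTwistedHubbardTorus L U (fun _ : Fin 2 => t)) N 0 χ₂ →
      ∃ z : ℂ, χ₂ = z • χ₁ := fun t ht =>
    huniq_diag t (by linarith [ht.1, Real.pi_pos]) (by simp only [htm] at ht; linarith [ht.2])
      (by rw [abs_of_nonneg ht.1]; simp only [htm] at ht; linarith [ht.2])
  have huniq_hi : ∀ t ∈ Set.Icc tp Real.pi, ∀ χ₁ χ₂ : Fock (Orb (FermionTorus 2 L)),
      IsGroundStateInSector (spinTwistedHubbardTorus L U (fun _ : Fin 2 => t)) N 0 χ₁ →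
      IsGroundStateInSector (spinTwistedHubbardTorus L U (fun _ : Fin 2 => t)) N 0 χ₂ →
      ∃ z : ℂ, χ₂ = z • χ₁ := fun t ht =>
    huniq_diag t (by simp only [htp] at ht; linarith [ht.1, Real.pi_pos]) ht.2
      (by simp only [htp] at ht; rw [abs_of_nonneg (by linarith [ht.1])]; linarith [ht.1])
  -- sector ground states at the two vertices
  have hK : (szSector N 0 : Submodule ℂ (Fock (Orb (FermionTorus 2 L)))) ≠ ⊥ :=
    (Submodule.ne_bot_iff _).2 ⟨χ₀, hχ₀.1, hχ₀.2.1⟩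
  have hexist : ∀ τ : ℝ, ∃ ξ,
      IsGroundStateInSector (spinTwistedHubbardTorus L U (fun _ : Fin 2 => τ)) N 0 ξ := fun τ => by
    obtain ⟨v, hv, h1, he⟩ := exists_unit_eigen_minEnergyOn
      (spinTwistedHubbardTorus_isHermitian L U (fun _ : Fin 2 => τ)) (szSector N 0)
      (fun v hv => spinTwistedHubbardTorus_mulVec_mem_szSector L U _ hv) hK
    exact ⟨v, hv, ne_zero_of_unit h1, he⟩
  obtain ⟨χp, hχp⟩ := hexist tp
  obtain ⟨χm, hχm⟩ := hexist tm
  have htpI : tp ∈ Set.Icc tp Real.pi := ⟨le_rfl, by simp only [htp]; linarith⟩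
  have htmI : tm ∈ Set.Icc 0 tm := ⟨by simp only [htm]; linarith, le_rfl⟩
  -- the flip across `(c, c)`
  have hflip := swapSign_opposite_of_holonomy_neg L U N (fun _ : Fin 2 => c) rfl r hII
    (χp := χp) (χm := χm) (by rw [hqp]; exact hχp)
    (by rw [hqp]; exact fun χ' h => huniq_hi tp htpI χp χ' hχp h)
    (by rw [hqm]; exact hχm) (by rw [hqm]; exact fun χ' h => huniq_lo tm htmI χm χ' hχm h)
  -- constancy on the two segments
  obtain ⟨shi, hshi⟩ := swapSign_const_on_diagonal_segment L U N tp Real.pi huniq_hi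
  obtain ⟨slo, hslo⟩ := swapSign_const_on_diagonal_segment L U N 0 tm huniq_lo
  have hπI : Real.pi ∈ Set.Icc tp Real.pi := ⟨by simp only [htp]; linarith, le_rfl⟩
  have h0I : (0 : ℝ) ∈ Set.Icc 0 tm := ⟨le_rfl, by simp only [htm]; linarith⟩
  have hχ₀' : IsGroundStateInSector (spinTwistedHubbardTorus L U (fun _ : Fin 2 => (0 : ℝ))) N 0 χ₀ := by
    rw [show (fun _ : Fin 2 => (0 : ℝ)) = 0 from rfl, spinTwistedHubbardTorus_zero L hL U]
    exact hχ₀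
  have hsp := hshi tp htpI χp hχp
  have hsπ := hshi Real.pi hπI χπ hχπ
  have hsm := hslo tm htmI χm hχm
  have hs0 := hslo 0 h0I χ₀ hχ₀'
  -- read off the signs
  rcases hflip with ⟨hfp, hfm⟩ | ⟨hfp, hfm⟩
  · right
    have h1 : shi = 1 := smul_left_injective ℂ hχp.2.1 (by simp only; rw [← hsp, hfp, one_smul])
    have h2 : slo = -1 := smul_left_injective ℂ hχm.2.1 (by simp only; rw [← hsm, hfm, neg_one_smul])
    refine ⟨?_, ?_⟩
    · rw [hs0, h2, neg_one_smul]
    · rw [hsπ, h1, one_smul]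
  · left
    have h1 : shi = -1 := smul_left_injective ℂ hχp.2.1 (by simp only; rw [← hsp, hfp, neg_one_smul])
    have h2 : slo = 1 := smul_left_injective ℂ hχm.2.1 (by simp only; rw [← hsm, hfm, one_smul])
    refine ⟨?_, ?_⟩
    · rw [hs0, h2, one_smul]
    · rw [hsπ, h1, neg_one_smul]

end Global

/-- **Registered sub-goal `stub_swapParityZeroVsPi` of crux stmt-HubbardSuperconductivity-10395**
(lead c12, line `birth`; structural input to stub C): the statement of
`swapSign_pi_opposite_swapSign_zero` with all binders explicit and all names fully qualified —
under clause (I) of the nodal-Dirac package on the cell and the holonomy clause (II) at the diagonal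
Dirac point `(c, c)` for one radius `0 < r < min(c, π - c)`, the `x ↔ y` (swap) parity of every
`(N, S^z = 0)` sector ground state of `hubbardTorus 2 L 1 U` is opposite to that of every sector
ground state of the spin-twisted torus at the twist `(π, π)` (`L ≥ 3`). Hatsugai, J. Phys. Soc.
Jpn. 75 (2006) 123601; Kato (1966) II §5.1. [folklore] -/
theorem stub_swapParityZeroVsPi : ∀ (L : ℕ) [NeZero L], 3 ≤ L → ∀ (U : ℝ) (N : ℕ) (c : ℝ), (∀ φ : Fin 2 → ℝ, φ 0 ∈ Set.Ioc (-Real.pi) Real.pi → φ 1 ∈ Set.Ioc (-Real.pi) Real.pi → ((∃ ψ₁ ψ₂ : Literature.MathematicalPhysics.QuantumLattice.Fock (Literature.MathematicalPhysics.QuantumLattice.Orb (Literature.MathematicalPhysics.QuantumLattice.FermionTorus 2 L)), Literature.MathematicalPhysics.QuantumLattice.IsGroundStateInSector (Literature.MathematicalPhysics.QuantumLattice.spinTwistedHubbardTorus L U φ) N 0 ψ₁ ∧ Literature.MathematicalPhysics.QuantumLattice.IsGroundStateInSector (Literature.MathematicalPhysics.QuantumLattice.spinTwistedHubbardTorus L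 U φ) N 0 ψ₂ ∧ star ψ₁ ⬝ᵥ ψ₂ = 0) ↔ (|φ 0| = c ∧ |φ 1| = c))) → ∀ (p : Fin 2 → ℝ), p 0 = c → p 1 = c → ∀ (r : ℝ), 0 < r → r < min c (Real.pi - c) → (∃ n₀ : ℕ, ∀ n ≥ n₀, ∀ ψ : Fin n → Literature.MathematicalPhysics.QuantumLattice.Fock (Literature.MathematicalPhysics.QuantumLattice.Orb (Literature.MathematicalPhysics.QuantumLattice.FermionTorus 2 L)), (∀ i : Fin n, Literature.MathematicalPhysics.QuantumLattice.IsGroundStateInSector (Literature.MathematicalPhysics.QuantumLattice.spinTwistedHubbardTorus L U (fun ν : Fin 2 => p ν + r * (if ν = 0 then Real.cos (2 * Real.pi * (i : ℕ) / n) else Real.sin (2 * Real.pi * (i : ℕ) / n)))) N 0 (ψ i) ∧ star (ψ i) ⬝ᵥ ψ i = 1) → (∏ i : Fin n, star (ψ i) ⬝ᵥ ψ (finRotate n i)).re < 0) → ∀ (χ₀ χπ : Literature.MathematicalPhysics.QuantumLattice.Fock (Literature.MathematicalPhysics.QuantumLattice.Orb (Literature.MathematicalPhysics.QuantumLattice.FermionTorus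 2 L))), Literature.MathematicalPhysics.QuantumLattice.IsGroundStateInSector (Literature.MathematicalPhysics.QuantumLattice.hubbardTorus 2 L 1 U) N 0 χ₀ → Literature.MathematicalPhysics.QuantumLattice.IsGroundStateInSector (Literature.MathematicalPhysics.QuantumLattice.spinTwistedHubbardTorus L U (fun _ : Fin 2 => Real.pi)) N 0 χπ → (Matrix.mulVec (Literature.MathematicalPhysics.QuantumLattice.fockD4 (L := L) (DihedralGroup.sr 3)).val χ₀ = χ₀ ∧ Matrix.mulVec (Literature.MathematicalPhysics.QuantumLattice.fockD4 (L := L) (DihedralGroup.sr 3)).val χπ = -χπ) ∨ (Matrix.mulVec (Literature.MathematicalPhysics.QuantumLattice.fockD4 (L := L) (DihedralGroup.sr 3)).val χ₀ = -χ₀ ∧ Matrix.mulVec (Literature.MathematicalPhysics.QuantumLattice.fockD4 (L := L) (DihedralGroup.sr 3)).val χπ = χπ) :=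
  fun L _ hL U N _ hI p hp0 hp1 _ hr0 hrc hII _ _ hχ₀ hχπ =>
    swapSign_pi_opposite_swapSign_zero L hL U N hI p hp0 hp1 hr0 hrc hII hχ₀ hχπ

end Summit.HubbardSuperconductivity.HubbardSuperconductivity.Theorems.NodalDiracTwist.BridgeNodalToDWave

end
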